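import Mathlib.Analysis.Normed.Affine.AddTorsor
import Literature.Probability.Percolation.FlipFairKernel
import Literature.Probability.Percolation.QuadCrossingRawClosed
import Literature.Probability.Percolation.QuadCrossingSubquadTopology
import Literature.Probability.Percolation.Z2PivotalMeasure
import HarnessLib

/-!
# Lattice pivotality of an edge of `δℤ²` versus `QuadConfig.IsPivotalAt`: the lattice half

Topic `Literature/Probability/Percolation`; proofs file next to `FlipFairKernel.lean` (the
continuum pivotal predicate `QuadConfig.IsPivotalAt S x Q` — "flipping at `x` toggles `Q`" — whose
OPEN form reads: `Q ∈ S`, and no sub-quad of `Q` with landing sides inside those of `Q` and carrier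
off some ball around `x` is crossed) and to `Z2PivotalMeasure.lean` (the lattice side: the edges
`edgeFrom x i = s(x, x + eᵢ)` of `ℤ²`, drawn at mesh `δ` as the segment `[δx, δ(x + eᵢ)]` with
midpoint `edgeMidpoint δ x i`; the configurations `ω_δ = z2QuadConfig D δ ω ∈ ℋ_D` of
`QuadCrossingSpaceZ2.lean`, read without closure by `mem_z2QuadConfig_iff_exists_isCrossing` of
`QuadCrossingRawClosed.lean`).  No named fact is introduced; everything is proved.

On the lattice the edge `e` is (open-)pivotal for the quad `Q` in `ω` when `Q ∈ ω_δ` but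
`Q ∉ (ω ∖ {e})_δ` (Garban–Pete–Schramm: a point is "pivotal for a quad if changing its state changes
the crossing event", arXiv:1008.1378 §1.1, there for hexagons of `𝕋`).  We prove that this implies
the continuum predicate at the midpoint of `e` for the configuration `ω_δ`, for every quad whose
landing sides `∂₀Q`, `∂₂Q` do not meet the drawn segment of `e` ("non-straddling" edges):

* `isPivotalAt_z2QuadConfig_of_not_mem_sdiff` — **lattice-pivotal ⟹ `IsPivotalAt` (open clause),
  for non-straddling edges**; and its toggled form `isPivotalAt_z2QuadConfig_insert_of_not_iff`
  for the patterns `¬ (Q ∈ ω_δ ↔ Q ∈ (ω ∆ {e})_δ)` of the lattice Campbell–Mecke identity (in both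
  lattice cases, `e` open or closed in `ω`, the configuration with `e` opened is open-pivotal at
  the midpoint of `e`);
* the clean no-spur case `not_mem_z2QuadConfig_of_disjoint_segment`: a sub-quad of `Q` off the
  whole segment of `e` that is crossed in `ω` is crossed in `ω ∖ {e}`;
* the **dangling-spur removal** behind the first item, `isCrossing_inter_openEdgeUnion_sdiff`: a
  crossing `K` of `Q` inside the drawn open edges of `ω` avoiding a ball around the midpoint of `e`
  meets the segment of `e` in two end-pieces only, each attached to the rest of the drawing through
  its lattice endpoint alone (distinct lattice edges meet only at common endpoints,
  `eq_endpoint_of_mem_segment_of_mem_segment`); discarding them leaves the crossing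
  `K ∩ O_{ω ∖ {e}}` of `Q`, by the point-set lemma `IsPreconnected.inter_of_whisker` — **removing
  a closed whisker attached at a single point keeps a connected set connected**.

Not here.  The converse (open clause at the midpoint ⟹ lattice pivotality) needs the thickening of
a polygonal crossing of `Q` in `ω ∖ {e}` into a crossed sub-quad of `Q` avoiding a ball — a
Schoenflies-type construction for arbitrary topological quads that the tree does not have.  The
CLOSED clause of `IsPivotalAt` has no counterpart at fixed mesh (the open arms of a closed
lattice-pivotal edge end at its endpoints, at distance `δ/2` from the midpoint).

## References

* [GarbanPeteSchramm2013Pivotal] C. Garban, G. Pete, O. Schramm, *Pivotal, cluster and interface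
  measures for critical planar percolation*, JAMS 26 (2013), arXiv:1008.1378, §1.1.
* [SchrammSmirnov2011] O. Schramm, S. Smirnov, Ann. Probab. 39 (2011), arXiv:1101.5820, §1.3
  (crossings of quads, the configuration `S_ω`).
-/

noncomputable section

open Set Metric
open scoped symmDiff
open Literature.Probability.LatticeModels

namespace Literature.Probability.Percolation

/-! ### Removing a whisker keeps a connected set connected -/

/-- **Removing a closed whisker attached at a single point keeps a connected set connected.**  If a
preconnected set `K` lies in the union of two closed sets `F` and `P` meeting at most in the point
`p`, then `K ∩ F` is preconnected: a separation of `K ∩ F` by closed sets `C₁`, `C₂` extends to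
the separation of `K` by `(C₁ ∩ F) ∪ P` and `C₂ ∩ F` once `P` is put on the side of `p`.
[folklore] -/
theorem IsPreconnected.inter_of_whisker {X : Type*} [TopologicalSpace X] {K F P : Set X} {p : X}
    (hK : IsPreconnected K) (hF : IsClosed F) (hP : IsClosed P) (hKFP : K ⊆ F ∪ P)
    (hFP : F ∩ P ⊆ {p}) : IsPreconnected (K ∩ F) := by
  rw [isPreconnected_iff_subset_of_disjoint_closed] at hK ⊢
  -- the asymmetric case: `p` is not a point of `K ∩ F` inside `C₂`
  have aux : ∀ C₁ C₂ : Set X, IsClosed C₁ → IsClosed C₂ → K ∩ F ⊆ C₁ ∪ C₂ →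
      K ∩ F ∩ (C₁ ∩ C₂) = ∅ → ¬ (p ∈ K ∩ F ∧ p ∈ C₂) → K ∩ F ⊆ C₁ ∨ K ∩ F ⊆ C₂ := by
    intro C₁ C₂ hC₁ hC₂ hsub hdisj hp
    have hcov : K ⊆ (C₁ ∩ F ∪ P) ∪ C₂ ∩ F := fun z hzK => by
      rcases hKFP hzK with hzF | hzP
      · rcases hsub ⟨hzK, hzF⟩ with h1 | h2
        · exact Or.inl (Or.inl ⟨h1, hzF⟩)
        · exact Or.inr ⟨h2, hzF⟩
      · exact Or.inl (Or.inr hzP)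
    have hdis : K ∩ ((C₁ ∩ F ∪ P) ∩ (C₂ ∩ F)) = ∅ := by
      refine eq_empty_of_forall_notMem fun z ⟨hzK, hz1, hz2⟩ => ?_
      rcases hz1 with hz1 | hzP
      · have hz : z ∈ K ∩ F ∩ (C₁ ∩ C₂) := ⟨⟨hzK, hz2.2⟩, hz1.1, hz2.1⟩
        rw [hdisj] at hz
        exact hz
      · have hzp : z = p := hFP ⟨hz2.2, hzP⟩
        subst hzp
        exact hp ⟨⟨hzK, hz2.2⟩, hz2.1⟩
    rcases hK _ _ ((hC₁.inter hF).union hP) (hC₂.inter hF) hcov hdis with h | h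
    · refine Or.inl fun z hz => ?_
      rcases h hz.1 with hz1 | hzP
      · exact hz1.1
      · have hzp : z = p := hFP ⟨hz.2, hzP⟩
        subst hzp
        exact (hsub hz).resolve_right fun h2 => hp ⟨hz, h2⟩
    · exact Or.inr fun z hz => (h hz.1).1
  intro C₁ C₂ hC₁ hC₂ hsub hdisj
  by_cases hp : p ∈ K ∩ F ∧ p ∈ C₂
  · have hp' : ¬ (p ∈ K ∩ F ∧ p ∈ C₁) := fun h => by
      have : p ∈ K ∩ F ∩ (C₁ ∩ C₂) := ⟨h.1, h.2, hp.2⟩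
      rw [hdisj] at this
      exact this
    rw [union_comm] at hsub
    rw [inter_comm C₁] at hdisj
    exact (aux C₂ C₁ hC₂ hC₁ hsub hdisj hp').symm
  · exact aux C₁ C₂ hC₁ hC₂ hsub hdisj hp

open QuadCrossing

variable {D : Set ℂ} {δ : ℝ} {ω : BondConfig (Site 2)} {x : Site 2} {i : Fin 2}

/-! ### The drawn segment of an edge against the other drawn edges -/

/-- The two ends of `edgeFrom x i` are drawn at distance `|δ|`. [folklore] -/
theorem dist_meshPoint_ends_edgeFrom (δ : ℝ) (x : Site 2) (i : Fin 2) :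
    dist (meshPoint δ x) (meshPoint δ (x + Pi.single i 1)) = |δ| := by
  -- as `dist_meshPoint_of_adj` (`BoxCrossingProofs.lean`, not imported here)
  rw [Complex.dist_eq]
  have hre : (meshPoint δ x - meshPoint δ (x + Pi.single i 1)).re =
      -(δ * (Pi.single (M := fun _ : Fin 2 => ℤ) i (1 : ℤ) 0 : ℤ)) := by
    simp only [Complex.sub_re, meshPoint_re, Pi.add_apply, Int.cast_add]; ring
  have him : (meshPoint δ x - meshPoint δ (x + Pi.single i 1)).im =
      -(δ * (Pi.single (M := fun _ : Fin 2 => ℤ) i (1 : ℤ) 1 : ℤ)) := by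
    simp only [Complex.sub_im, meshPoint_im, Pi.add_apply, Int.cast_add]; ring
  rw [← Complex.re_add_im (meshPoint δ x - meshPoint δ (x + Pi.single i 1)), hre, him]
  fin_cases i
  · simp [Complex.norm_real]
  · simp

/-- The midpoint of the drawn edge is the affine midpoint of its segment:
`edgeMidpoint δ x i = lineMap (δx) (δ(x + eᵢ)) (1/2)`. [folklore] -/
theorem edgeMidpoint_eq_lineMap (δ : ℝ) (x : Site 2) (i : Fin 2) :
    edgeMidpoint δ x i =
      AffineMap.lineMap (meshPoint δ x) (meshPoint δ (x + Pi.single i 1)) (1 / 2 : ℝ) := by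
  rw [AffineMap.lineMap_apply_module', edgeMidpoint, Complex.real_smul]
  push_cast
  ring

/-- The midpoint of a drawn edge lies on its segment. [folklore] -/
theorem edgeMidpoint_mem_segment (δ : ℝ) (x : Site 2) (i : Fin 2) :
    edgeMidpoint δ x i ∈ segment ℝ (meshPoint δ x) (meshPoint δ (x + Pi.single i 1)) := by
  rw [segment_eq_image_lineMap, edgeMidpoint_eq_lineMap]
  exact ⟨1 / 2, ⟨by norm_num, by norm_num⟩, rfl⟩

/-- The first end of a drawn edge is at distance `δ/2` from its midpoint (`0 ≤ δ`). [folklore] -/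
theorem dist_meshPoint_edgeMidpoint_eq (hδ : 0 ≤ δ) (x : Site 2) (i : Fin 2) :
    dist (meshPoint δ x) (edgeMidpoint δ x i) = δ / 2 := by
  rw [edgeMidpoint_eq_lineMap, dist_left_lineMap, dist_meshPoint_ends_edgeFrom, abs_of_nonneg hδ,
    Real.norm_eq_abs, abs_of_nonneg (by norm_num : (0 : ℝ) ≤ 1 / 2)]
  ring

/-- The second end of a drawn edge is at distance `δ/2` from its midpoint (`0 ≤ δ`). [folklore] -/
theorem dist_meshPoint_add_single_edgeMidpoint_eq (hδ : 0 ≤ δ) (x : Site 2) (i : Fin 2) :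
    dist (meshPoint δ (x + Pi.single i 1)) (edgeMidpoint δ x i) = δ / 2 := by
  rw [edgeMidpoint_eq_lineMap, dist_comm, dist_lineMap_right, dist_meshPoint_ends_edgeFrom,
    abs_of_nonneg hδ, Real.norm_eq_abs, abs_of_nonneg (by norm_num : (0 : ℝ) ≤ 1 - 1 / 2)]
  ring

/-- **The segment of `e = s(x, x + eᵢ)` meets the drawn edges of `ω ∖ {e}` only at its two ends**
(`δ ≠ 0`): distinct lattice edges meet only at common endpoints. [folklore] -/
theorem eq_ends_of_mem_segment_of_mem_openEdgeUnion_sdiff (hδ : δ ≠ 0) {z : ℂ}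
    (hz : z ∈ segment ℝ (meshPoint δ x) (meshPoint δ (x + Pi.single i 1)))
    (hz' : z ∈ openEdgeUnion δ (ω \ {edgeFrom x i})) :
    z = meshPoint δ x ∨ z = meshPoint δ (x + Pi.single i 1) := by
  obtain ⟨a, b, hab, hω, hzab⟩ := mem_openEdgeUnion_iff.1 hz'
  have hne : s(x, x + Pi.single i 1) ≠ s(a, b) := fun h =>
    hω.2 (by rw [mem_singleton_iff, edgeFrom]; exact h.symm)
  exact eq_endpoint_of_mem_segment_of_mem_segment hδ ((zdGraph_adj_iff x _).2 ⟨i, Or.inl rfl⟩) hab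
    hne hz hzab

/-- The drawn edges of `ω` lie in those of `ω ∖ {e}` together with the segment of `e`. [folklore] -/
theorem openEdgeUnion_subset_sdiff_union_segment (δ : ℝ) (ω : BondConfig (Site 2)) (x : Site 2)
    (i : Fin 2) : openEdgeUnion δ ω ⊆ openEdgeUnion δ (ω \ {edgeFrom x i}) ∪
      segment ℝ (meshPoint δ x) (meshPoint δ (x + Pi.single i 1)) := by
  intro z hz
  obtain ⟨a, b, hab, hω, hzab⟩ := mem_openEdgeUnion_iff.1 hz
  by_cases h : s(a, b) = edgeFrom x i
  · right
    unfold edgeFrom at h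
    rcases Sym2.eq_iff.1 h with ⟨rfl, rfl⟩ | ⟨rfl, rfl⟩
    · exact hzab
    · rw [segment_symm]; exact hzab
  · exact Or.inl (mem_openEdgeUnion_iff.2 ⟨a, b, hab, ⟨hω, h⟩, hzab⟩)

/-- Off the segment of `e`, the drawn edges of `ω` are drawn edges of `ω ∖ {e}`. [folklore] -/
theorem mem_openEdgeUnion_sdiff_of_not_mem_segment {z : ℂ} (hz : z ∈ openEdgeUnion δ ω)
    (hzs : z ∉ segment ℝ (meshPoint δ x) (meshPoint δ (x + Pi.single i 1))) :
    z ∈ openEdgeUnion δ (ω \ {edgeFrom x i}) :=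
  (openEdgeUnion_subset_sdiff_union_segment δ ω x i hz).resolve_right hzs

/-- A point of the segment of `e` off the ball `B(mid e, ε)` is within `δ/2 - ε` of one of the two
ends of `e` (`0 < δ`): the segment minus the ball consists of two end-pieces. [folklore] -/
theorem mem_closedBall_ends_of_mem_segment (hδ : 0 < δ) {ε : ℝ} {z : ℂ}
    (hz : z ∈ segment ℝ (meshPoint δ x) (meshPoint δ (x + Pi.single i 1)))
    (hzb : z ∉ ball (edgeMidpoint δ x i) ε) :
    z ∈ closedBall (meshPoint δ x) (δ / 2 - ε) ∨
      z ∈ closedBall (meshPoint δ (x + Pi.single i 1)) (δ / 2 - ε) := by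
  have hd : dist (meshPoint δ x) (meshPoint δ (x + Pi.single i 1)) = δ := by
    rw [dist_meshPoint_ends_edgeFrom, abs_of_pos hδ]
  rw [segment_eq_image_lineMap] at hz
  obtain ⟨t, ⟨ht0, ht1⟩, rfl⟩ := hz
  rw [edgeMidpoint_eq_lineMap, mem_ball, dist_lineMap_lineMap, hd, not_lt, Real.dist_eq] at hzb
  rw [mem_closedBall, mem_closedBall, dist_lineMap_left, dist_lineMap_right, hd, Real.norm_eq_abs,
    Real.norm_eq_abs, abs_of_nonneg ht0, abs_of_nonneg (sub_nonneg.2 ht1)]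
  rcases le_total t (1 / 2) with h | h
  · left
    rw [abs_of_nonpos (sub_nonpos.2 h)] at hzb
    nlinarith
  · right
    rw [abs_of_nonneg (sub_nonneg.2 h)] at hzb
    nlinarith

/-! ### Dangling-spur removal -/

/-- **Dangling-spur removal.**  Let `K` be a crossing of the quad `Q` inside the drawn open edges
of `ω` (`δ > 0`) avoiding the ball `B(mid e, ε)` around the midpoint of the edge
`e = s(x, x + eᵢ)`, and suppose the landing sides `∂₀Q`, `∂₂Q` do not meet the segment of `e`.
Then `K ∩ O_{ω ∖ {e}}` (the points of `K` on drawn edges other than `e`) is again a crossing of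
`Q`.  Indeed `K` meets the segment of `e` only inside its two end-pieces off the ball, two disjoint
closed sets each meeting the closed set `O_{ω ∖ {e}}` at most in its lattice endpoint (distinct
lattice edges meet only at common ends), so they are whiskers of `K` in the sense of
`IsPreconnected.inter_of_whisker`; and the side points of `K` are off the segment. [folklore] -/
theorem isCrossing_inter_openEdgeUnion_sdiff (hδ : 0 < δ) {Q : Quad D} {K : Set ℂ} {ε : ℝ}
    (hε : 0 < ε) (hK : Q.IsCrossing K) (hKω : K ⊆ openEdgeUnion δ ω)
    (hKb : Disjoint K (ball (edgeMidpoint δ x i) ε))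
    (h0 : Disjoint (Q.side 0) (segment ℝ (meshPoint δ x) (meshPoint δ (x + Pi.single i 1))))
    (h2 : Disjoint (Q.side 2) (segment ℝ (meshPoint δ x) (meshPoint δ (x + Pi.single i 1)))) :
    Q.IsCrossing (K ∩ openEdgeUnion δ (ω \ {edgeFrom x i})) := by
  set u := meshPoint δ x with hu
  set v := meshPoint δ (x + Pi.single i 1) with hv
  set F := openEdgeUnion δ (ω \ {edgeFrom x i}) with hF
  obtain ⟨hKc, hKconn, hKQ, ⟨z₀, hz₀K, hz₀⟩, ⟨z₂, hz₂K, hz₂⟩⟩ := hK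
  have hFc : IsClosed F := isClosed_openEdgeUnion hδ _
  have hz₀F : z₀ ∈ F :=
    mem_openEdgeUnion_sdiff_of_not_mem_segment (hKω hz₀K) (Set.disjoint_left.1 h0 hz₀)
  have hz₂F : z₂ ∈ F :=
    mem_openEdgeUnion_sdiff_of_not_mem_segment (hKω hz₂K) (Set.disjoint_left.1 h2 hz₂)
  refine ⟨hKc.inter_right hFc, ⟨⟨z₀, hz₀K, hz₀F⟩, ?_⟩, inter_subset_left.trans hKQ,
    ⟨z₀, ⟨hz₀K, hz₀F⟩, hz₀⟩, ⟨z₂, ⟨hz₂K, hz₂F⟩, hz₂⟩⟩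
  -- the two end-pieces of the segment of `e` off the ball
  set Pu : Set ℂ := segment ℝ u v ∩ closedBall u (δ / 2 - ε) with hPu
  set Pv : Set ℂ := segment ℝ u v ∩ closedBall v (δ / 2 - ε) with hPv
  have hsegc : IsClosed (segment ℝ u v) := (isCompact_segment_complex u v).isClosed
  have hPuc : IsClosed Pu := hsegc.inter isClosed_closedBall
  have hPvc : IsClosed Pv := hsegc.inter isClosed_closedBall
  have hduv : dist u v = δ := by rw [hu, hv, dist_meshPoint_ends_edgeFrom, abs_of_pos hδ]
  have hcover : K ⊆ F ∪ Pv ∪ Pu := fun z hz => by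
    rcases openEdgeUnion_subset_sdiff_union_segment δ ω x i (hKω hz) with hzF | hzs
    · exact Or.inl (Or.inl hzF)
    · have hzb : z ∉ ball (edgeMidpoint δ x i) ε := fun hb => Set.disjoint_left.1 hKb hz hb
      rcases mem_closedBall_ends_of_mem_segment hδ hzs hzb with h | h
      · exact Or.inr ⟨hzs, h⟩
      · exact Or.inl (Or.inr ⟨hzs, h⟩)
  have hFPu : ∀ z ∈ F, z ∈ Pu → z = u := fun z hzF hzP => by
    rcases eq_ends_of_mem_segment_of_mem_openEdgeUnion_sdiff hδ.ne' hzP.1 hzF with h | h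
    · exact h
    · exfalso
      have h' : dist z u ≤ δ / 2 - ε := hzP.2
      rw [h, dist_comm, hduv] at h'
      linarith
  have hFPv : ∀ z ∈ F, z ∈ Pv → z = v := fun z hzF hzP => by
    rcases eq_ends_of_mem_segment_of_mem_openEdgeUnion_sdiff hδ.ne' hzP.1 hzF with h | h
    · exfalso
      have h' : dist z v ≤ δ / 2 - ε := hzP.2
      rw [h, hduv] at h'
      linarith
    · exact h
  have hPvPu : ∀ z ∈ Pv, z ∉ Pu := fun z hzv hzu => by
    have h1 : dist z u ≤ δ / 2 - ε := hzu.2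
    have h2 : dist z v ≤ δ / 2 - ε := hzv.2
    have h3 := dist_triangle_left u v z
    rw [hduv] at h3
    linarith
  -- remove the whisker at `u`, then the whisker at `v`
  have h1 : IsPreconnected (K ∩ (F ∪ Pv)) :=
    IsPreconnected.inter_of_whisker hKconn.isPreconnected (hFc.union hPvc) hPuc hcover
      fun z hz => by
        rcases hz.1 with hzF | hzv
        · exact hFPu z hzF hz.2
        · exact (hPvPu z hzv hz.2).elim
  have h2 : IsPreconnected (K ∩ (F ∪ Pv) ∩ F) :=
    IsPreconnected.inter_of_whisker h1 hFc hPvc inter_subset_right fun z hz => hFPv z hz.1 hz.2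
  rwa [inter_assoc, union_inter_cancel_left] at h2

/-! ### Lattice-pivotal edges are open-pivotal at their midpoint -/

/-- **No-spur case.**  If `Q` is not crossed in `ω ∖ {e}`, then no sub-quad `Q'` of `Q` with landing
sides inside those of `Q` and carrier off the whole segment of `e` is crossed in `ω`: a crossing of
`Q'` inside the drawn edges of `ω` lies off the segment, hence inside the drawn edges of `ω ∖ {e}`,
and is a crossing of `Q`. [folklore] -/
theorem not_mem_z2QuadConfig_of_disjoint_segment (hδ : 0 < δ) {Q Q' : Quad D}
    (hQ : Q ∉ z2QuadConfig D δ (ω \ {edgeFrom x i})) (hcar : Q'.carrier ⊆ Q.carrier)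
    (hseg : Disjoint Q'.carrier (segment ℝ (meshPoint δ x) (meshPoint δ (x + Pi.single i 1))))
    (h0 : Q'.side 0 ⊆ Q.side 0) (h2 : Q'.side 2 ⊆ Q.side 2) : Q' ∉ z2QuadConfig D δ ω := by
  intro hQ'
  obtain ⟨K, hK, hKω⟩ := (mem_z2QuadConfig_iff_exists_isCrossing hδ).1 hQ'
  exact hQ ((mem_z2QuadConfig_iff_exists_isCrossing hδ).2 ⟨K, hK.of_subquad hcar h0 h2,
    fun z hz => mem_openEdgeUnion_sdiff_of_not_mem_segment (hKω hz)
      (Set.disjoint_left.1 hseg (hK.2.2.1 hz))⟩)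

/-- **Lattice-pivotal ⟹ open-pivotal (`QuadConfig.IsPivotalAt`), for non-straddling edges.**
Let `δ > 0`, `e = s(x, x + eᵢ)`, and let `Q` be a quad whose landing sides `∂₀Q`, `∂₂Q` do not meet
the drawn segment of `e`.  If `Q ∈ ω_δ` but `Q ∉ (ω ∖ {e})_δ` (the edge is pivotal for the crossing
of `Q` on the lattice), then the midpoint of `e` is pivotal for `Q` in the configuration `ω_δ`, in
the open form: for every `ε > 0`, no sub-quad `Q'` of `Q` with `[Q'] ⊆ [Q] ∖ B(mid e, ε)`,
`∂₀Q' ⊆ ∂₀Q`, `∂₂Q' ⊆ ∂₂Q` is crossed in `ω` — a crossing of such a `Q'` in `ω` is a crossing of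
`Q` avoiding the ball, and removing its dangling spurs on `e`
(`isCrossing_inter_openEdgeUnion_sdiff`) crosses `Q` in `ω ∖ {e}`.
[cite: GarbanPeteSchramm2013Pivotal, §1.1 (pivotal points for a quad)] -/
theorem isPivotalAt_z2QuadConfig_of_not_mem_sdiff (hδ : 0 < δ) {Q : Quad D}
    (hQ : Q ∈ z2QuadConfig D δ ω) (hQe : Q ∉ z2QuadConfig D δ (ω \ {edgeFrom x i}))
    (hns : segment ℝ (meshPoint δ x) (meshPoint δ (x + Pi.single i 1)) ∩ (Q.side 0 ∪ Q.side 2) = ∅) :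
    QuadConfig.IsPivotalAt (z2QuadConfig D δ ω) (edgeMidpoint δ x i) Q := by
  have h0 : Disjoint (Q.side 0) (segment ℝ (meshPoint δ x) (meshPoint δ (x + Pi.single i 1))) :=
    Set.disjoint_left.2 fun z hz hzs => (eq_empty_iff_forall_notMem.1 hns z) ⟨hzs, Or.inl hz⟩
  have h2 : Disjoint (Q.side 2) (segment ℝ (meshPoint δ x) (meshPoint δ (x + Pi.single i 1))) :=
    Set.disjoint_left.2 fun z hz hzs => (eq_empty_iff_forall_notMem.1 hns z) ⟨hzs, Or.inr hz⟩
  refine Or.inl ⟨hQ, fun ε hε Q' hcar h0' h2' hQ' => ?_⟩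
  obtain ⟨K, hK, hKω⟩ := (mem_z2QuadConfig_iff_exists_isCrossing hδ).1 hQ'
  have hKQ : Q.IsCrossing K := hK.of_subquad (hcar.trans Set.sdiff_subset) h0' h2'
  have hKb : Disjoint K (ball (edgeMidpoint δ x i) ε) :=
    Set.disjoint_left.2 fun z hz hb => (hcar (hK.2.2.1 hz)).2 hb
  exact hQe ((mem_z2QuadConfig_iff_exists_isCrossing hδ).2
    ⟨_, isCrossing_inter_openEdgeUnion_sdiff hδ hε hKQ hKω hKb h0 h2, inter_subset_right⟩)

/-- **The toggled-pattern form.**  If toggling the edge `e = s(x, x + eᵢ)` changes whether `Q` is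
crossed — `¬ (Q ∈ ω_δ ↔ Q ∈ (ω ∆ {e})_δ)`, the lattice pivotality of the Campbell–Mecke patterns —
and the landing sides of `Q` are off the segment of `e`, then the midpoint of `e` is (open-)pivotal
for `Q` in the configuration with `e` OPENED, `(ω ∪ {e})_δ` (which is `ω_δ` itself when `e ∈ ω`):
both lattice cases reduce to `isPivotalAt_z2QuadConfig_of_not_mem_sdiff` by monotonicity of
`ω ↦ ω_δ`. [cite: GarbanPeteSchramm2013Pivotal, §1.1 (pivotal points for a quad)] -/
theorem isPivotalAt_z2QuadConfig_insert_of_not_iff (hδ : 0 < δ) {Q : Quad D}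
    (h : ¬ (Q ∈ z2QuadConfig D δ ω ↔ Q ∈ z2QuadConfig D δ (ω ∆ {edgeFrom x i})))
    (hns : segment ℝ (meshPoint δ x) (meshPoint δ (x + Pi.single i 1)) ∩ (Q.side 0 ∪ Q.side 2) = ∅) :
    QuadConfig.IsPivotalAt (z2QuadConfig D δ (insert (edgeFrom x i) ω)) (edgeMidpoint δ x i) Q := by
  have hmono : ∀ {ω₁ ω₂ : BondConfig (Site 2)}, ω₁ ⊆ ω₂ →
      Q ∈ z2QuadConfig D δ ω₁ → Q ∈ z2QuadConfig D δ ω₂ := fun h₁₂ hQ =>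
    (QuadConfig.le_iff.1 (z2QuadConfig_mono D δ h₁₂)) hQ
  by_cases he : edgeFrom x i ∈ ω
  · have hsd : ω ∆ {edgeFrom x i} = ω \ {edgeFrom x i} := by
      rw [Set.symmDiff_def, Set.sdiff_eq_empty.2 (singleton_subset_iff.2 he), union_empty]
    rw [hsd] at h
    rw [insert_eq_of_mem he]
    have hQ : Q ∈ z2QuadConfig D δ ω := by
      by_contra hQ
      exact h ⟨fun h' => (hQ h').elim, fun h' => (hQ (hmono Set.sdiff_subset h')).elim⟩
    have hQe : Q ∉ z2QuadConfig D δ (ω \ {edgeFrom x i}) := fun h' => h ⟨fun _ => h', fun _ => hQ⟩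
    exact isPivotalAt_z2QuadConfig_of_not_mem_sdiff hδ hQ hQe hns
  · have hsd : ω ∆ {edgeFrom x i} = insert (edgeFrom x i) ω := by
      rw [Set.symmDiff_def, Set.sdiff_singleton_eq_self he,
        sdiff_eq_left.2 (disjoint_singleton_left.2 he), union_singleton]
    rw [hsd] at h
    have hQ' : Q ∈ z2QuadConfig D δ (insert (edgeFrom x i) ω) := by
      by_contra hQ'
      exact h ⟨fun h' => (hQ' (hmono (subset_insert _ _) h')).elim, fun h' => (hQ' h').elim⟩
    have hQ : Q ∉ z2QuadConfig D δ ω := fun h' => h ⟨fun _ => hQ', fun _ => h'⟩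
    have hQe : Q ∉ z2QuadConfig D δ (insert (edgeFrom x i) ω \ {edgeFrom x i}) := fun h' =>
      hQ (hmono (fun e he' => (mem_insert_iff.1 he'.1).resolve_left he'.2) h')
    exact isPivotalAt_z2QuadConfig_of_not_mem_sdiff hδ hQ' hQe hns

end Literature.Probability.Percolation
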